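import Summits.QuantumFields.YangMills.Theorems.FluctuationComparisonRegPrIntLOrganTangentFibreMeanTools
import HarnessLib

/-!
# Crux `FluctuationComparisonRegPrIntL` (stmt-QuantumFields-20520, rung R3), PATH-B organ, v18 (H-currency) — (L21a) TRANSPORT OF A DISINTEGRATION
# (generic measure theory): the fibre law over a displaced base point `g W` is the normalised `τ`-image of the `R`-reweighted fibre law over `W`

Cell `ym3-torus` (YM ladder rung R3 = continuum `SU(2)` Yang–Mills on the three-torus — a RUNG: NOT d = 4, NOT infinite volume, NOT a mass gap, NOT Clay).
Width seat `ym-ust-20520-w5` (gen 23; successor of the (L12)–(L20) MW-supplier lane of gen 22), `--supports stmt-QuantumFields-20520 --as helper`, count-neutral,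
no registry ∕ binder ∕ `Lines/` edit, DEFINITION-FREE, default heartbeats.  Companion file (L21b) `…OrganTangentFibreMeanTransport` carries the real-valued ∕
normalised-weight editions, the window upgrade and the frame edition (`dU_{Ts}`, `descendTo F ℰp j Ts`).

WHY.  LINᵘ-H (✓p804070 BRICK 1's `hL`) quantifies over EVERY Markov disintegration `σ` of `dU_{Ts}` along `descendTo F ℰp j Ts` (`(m.map d).bind σ = m` + fibre
clause) and concludes at the four corners `U, g₁U, g₂U, g₂g₁U` of a coarse one-bond square; BRICK 2b (✓p807533 `…OrganTangentFibreMeanSquareKnit`) reads the four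
corners on ONE fibre `(Ω, P)` — with `P := σ_U` in the adopted LIN currency (LEAD №9 (C): SPREAD-TRANSPORT-H ∧ FIBRE-LAW-H).  The dock is the identity below:
a fine transport `τ` COVERING the coarse move `g` carries `σ_W` to `σ_{gW}` up to its change-of-variables letter, FOR EVERY `σ` OF THE FRAME.

* §1 a.e. UNIQUENESS of `bind`-form disintegrations, finite-kernel edition (`ae_eq_of_bind_of_bind_finite`; ✓`OrganTangentFibreMeanTools.ae_eq_of_bind_of_bind`
  asks both kernels Markov — the transported kernel of §2 is only finite before normalisation is known a.e.).
* §2 ★★★`ae_eq_transport`: `m` finite on standard-Borel `Y`, `d : Y → X` measurable (`X` with measurable singletons), `σ` Markov with `bind` + fibre clause,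
  `g : X ≃ᵐ X`, `τ : Y → Y` measurable with (H-cov) `∀ U, d (τ U) = g (d U)` and (H-cv) `(m.withDensity R).map τ = m` (`R ≠ 0` measurable — the Jacobian ∕
  RN letter: `∫ f dm = ∫ (f∘τ)·R dm`) ⟹ for `(m.map d)`-a.e. `W`: `σ (g W) = (∫⁻ R ∂σ_W)⁻¹ • ((σ W).withDensity R).map τ`.  Mechanism:
  `V ↦ (Z (g⁻¹V))⁻¹ • ((σ (g⁻¹V)).withDensity R).map τ` is a SECOND disintegration of `m` along `d` — by ★`map_withDensity_eq` (`(R·m).map d = Z·(m.map d)`,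
  `Z W = ∫⁻ R ∂σ_W`), ★`map_eq_map_withDensity` (`m.map d = (Z·(m.map d)).map g`), ★`ae_lintegral_kernel_lt_top` (`Z < ∞` a.e.) — hence equals `σ` a.e. (§1);
  the null-preservation of `g` and `g⁻¹` for `m.map d` (★`map_map_absolutelyContinuous`, ★`map_symm_eq_withDensity`) is a CONSEQUENCE of (H-cv) and `R ≠ 0`,
  not an assumption.
* §3 the letters COMPOSE (for the diagonal corner `g₂ g₁ U`): ★`cv_comp` (`((R₁·(R₂∘τ₁))·m).map (τ₂∘τ₁) = m` from the two one-move letters), ★`cov_comp`,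
  ★`ae_comp_of_ae` (an `(m.map d)`-a.e. property holds at `g W` for a.e. `W`, so the identity at the corner `g₁U` is available for a.e. reference corner `U`).

HONEST FRAMING: disintegration ∕ change-of-variables plumbing over Mathlib (`eq_condKernel_of_measure_eq_compProd`) and a landed kernel fact; NO transport, NO
letter, NO weight is constructed for the runs' towers (they are HYPOTHESES of SPREAD-TRANSPORT-H ∕ FIBRE-LAW-H); nothing of Bałaban's analysis is asserted or
proved; LINᵘ-H ∕ JVARᵘ-H ∕ O1ᵘ-H v2 ∕ S1aᴴ ∕ 26243 ∕ S2α′ ∕ S2β OPEN; crux 20520 `FluctuationComparisonRegPrIntL` ∕ `YM3TorusSU2` NOT proved; no summit ∕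
sub-problem statement is proved; registry `Lines/semiclassical_s2beta.lean` untouched; rung R3 = SU(2) YM₃ on T³ at fixed lattice data — NOT d = 4, NOT
infinite volume, NOT a mass gap, NOT Clay; the Yang–Mills mass gap is NOT proved.  [folklore] measure theory.
-/

set_option autoImplicit false

noncomputable section

namespace Summit.QuantumFields.YangMills.Theorems.OrganTangentDisintegrationTransport

open MeasureTheory ProbabilityTheory Filter Topology Set
open scoped ENNReal

/-! ## §1 Disintegrations in `bind` form: a.e. uniqueness, finite-kernel edition -/

section Uniqueness

variable {X Y : Type*} [MeasurableSpace X] [MeasurableSpace Y]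

/-- `bind` + fibre clause ⇒ `compProd` form, for an s-finite kernel (✓`compProd_eq_map_graph_of_bind` asks Markov). [folklore] -/
theorem compProd_eq_map_graph_of_bind' (m : Measure Y) [IsFiniteMeasure m] {d : Y → X} (hd : Measurable d)
    (σ : Kernel X Y) [IsSFiniteKernel σ] (hbind : (m.map d).bind ⇑σ = m)
    (hfib : ∀ᵐ V ∂(m.map d), ∀ᵐ U ∂(σ V), d U = V) :
    (m.map d) ⊗ₘ σ = m.map (fun U => (d U, U)) := by
  have hg : Measurable (fun U : Y => (d U, U)) := hd.prodMk measurable_id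
  ext s hs
  rw [Measure.compProd_apply hs, Measure.map_apply hg hs]
  conv_rhs => rw [← hbind]
  rw [Measure.bind_apply (hg hs) σ.measurable.aemeasurable]
  refine lintegral_congr_ae ?_
  filter_upwards [hfib] with V hV
  refine measure_congr ?_
  filter_upwards [hV] with U hU
  show (U ∈ Prod.mk V ⁻¹' s) = (U ∈ (fun U : Y => (d U, U)) ⁻¹' s)
  rw [Set.mem_preimage, Set.mem_preimage, hU]

/-- **Two disintegrations of one measure along one map agree a.e. — one Markov, one merely FINITE** (standard Borel fibre space).
[folklore; Mathlib `eq_condKernel_of_measure_eq_compProd`] -/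
theorem ae_eq_of_bind_of_bind_finite [StandardBorelSpace Y] [Nonempty Y] (m : Measure Y) [IsFiniteMeasure m] {d : Y → X}
    (hd : Measurable d) (σ κ : Kernel X Y) [IsMarkovKernel σ] [IsFiniteKernel κ]
    (hbind : (m.map d).bind ⇑σ = m) (hfib : ∀ᵐ V ∂(m.map d), ∀ᵐ U ∂(σ V), d U = V)
    (hbindκ : (m.map d).bind ⇑κ = m) (hfibκ : ∀ᵐ V ∂(m.map d), ∀ᵐ U ∂(κ V), d U = V) :
    ∀ᵐ V ∂(m.map d), κ V = σ V := by
  have hg : Measurable (fun U : Y => (d U, U)) := hd.prodMk measurable_id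
  set ρ : Measure (X × Y) := m.map (fun U => (d U, U)) with hρ
  haveI : IsFiniteMeasure ρ := Measure.isFiniteMeasure_map m _
  have hfst : ρ.fst = m.map d := by
    rw [Measure.fst, hρ, Measure.map_map measurable_fst hg]
    rfl
  have h1 : ρ = ρ.fst ⊗ₘ σ := by rw [hfst, compProd_eq_map_graph_of_bind' m hd σ hbind hfib]
  have h2 : ρ = ρ.fst ⊗ₘ κ := by rw [hfst, compProd_eq_map_graph_of_bind' m hd κ hbindκ hfibκ]
  have e1 := eq_condKernel_of_measure_eq_compProd σ h1
  have e2 := eq_condKernel_of_measure_eq_compProd κ h2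
  rw [hfst] at e1 e2
  filter_upwards [e1, e2] with V h1V h2V
  rw [h1V, h2V]

end Uniqueness

/-! ## §2 Transport of a disintegration along a fibre-respecting map -/

section Transport

variable {X Y : Type*} [MeasurableSpace X] [MeasurableSpace Y]

/-- The fibre mass `Z W = ∫⁻ R ∂(σ W)` of an everywhere non-zero RN letter `R` under a Markov kernel is non-zero. [folklore] -/
theorem lintegral_kernel_ne_zero (σ : Kernel X Y) [IsMarkovKernel σ] {R : Y → ℝ≥0∞} (hR : Measurable R)
    (hRpos : ∀ U, R U ≠ 0) (W : X) : ∫⁻ U, R U ∂(σ W) ≠ 0 := by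
  intro h
  rw [lintegral_eq_zero_iff hR] at h
  have h0 : (σ W) {U | ¬ (R U = (0 : Y → ℝ≥0∞) U)} = 0 := ae_iff.mp h
  have huniv : {U | ¬ (R U = (0 : Y → ℝ≥0∞) U)} = univ := Set.eq_univ_of_forall (fun U => hRpos U)
  rw [huniv, measure_univ] at h0
  exact one_ne_zero h0

/-- **`bind` ⇒ iterated `lintegral`.**  `∫⁻ f dm = ∫⁻ W, ∫⁻ f ∂(σ W) ∂(m.map d)` for measurable `f`. [folklore] -/
theorem lintegral_eq_lintegral_kernel (m : Measure Y) {d : Y → X} (σ : Kernel X Y)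
    (hbind : (m.map d).bind ⇑σ = m) {f : Y → ℝ≥0∞} (hf : Measurable f) :
    ∫⁻ U, f U ∂m = ∫⁻ W, ∫⁻ U, f U ∂(σ W) ∂(m.map d) := by
  conv_lhs => rw [← hbind]
  exact Measure.lintegral_bind σ.measurable.aemeasurable hf.aemeasurable

/-- ★ **THE BASE LAW OF THE REWEIGHTED MEASURE.**  With `Z W := ∫⁻ R ∂(σ W)`: `(R·m).map d = Z·(m.map d)` (fibre clause). [folklore] -/
theorem map_withDensity_eq (m : Measure Y) {d : Y → X} (hd : Measurable d)
    (σ : Kernel X Y) (hbind : (m.map d).bind ⇑σ = m) (hfib : ∀ᵐ V ∂(m.map d), ∀ᵐ U ∂(σ V), d U = V)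
    {R : Y → ℝ≥0∞} (hR : Measurable R) :
    (m.withDensity R).map d = (m.map d).withDensity (fun W => ∫⁻ U, R U ∂(σ W)) := by
  ext s hs
  rw [Measure.map_apply hd hs, withDensity_apply _ (hd hs), ← lintegral_indicator (hd hs),
    lintegral_eq_lintegral_kernel m σ hbind ((hR.indicator (hd hs))), withDensity_apply _ hs, ← lintegral_indicator hs]
  refine lintegral_congr_ae ?_
  filter_upwards [hfib] with W hW
  by_cases hWs : W ∈ s
  · rw [Set.indicator_of_mem hWs]
    refine lintegral_congr_ae ?_
    filter_upwards [hW] with U hU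
    have hUs : U ∈ d ⁻¹' s := by rw [Set.mem_preimage, hU]; exact hWs
    rw [Set.indicator_of_mem hUs]
  · rw [Set.indicator_of_notMem hWs]
    have h0 : (fun U => (d ⁻¹' s).indicator R U) =ᵐ[σ W] fun _ => 0 := by
      filter_upwards [hW] with U hU
      have hUs : U ∉ d ⁻¹' s := by rw [Set.mem_preimage, hU]; exact hWs
      rw [Set.indicator_of_notMem hUs]
    rw [lintegral_congr_ae h0, lintegral_zero]

/-- ★ **THE BASE LAW IS THE `g`-IMAGE OF ITS `Z`-REWEIGHTING**: `m.map d = (Z·(m.map d)).map g` — from the covering identity `d ∘ τ = g ∘ d` and the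
change of variables `(R·m).map τ = m`. [folklore] -/
theorem map_eq_map_withDensity (m : Measure Y) {d : Y → X} (hd : Measurable d)
    (σ : Kernel X Y) (hbind : (m.map d).bind ⇑σ = m) (hfib : ∀ᵐ V ∂(m.map d), ∀ᵐ U ∂(σ V), d U = V)
    {g : X → X} (hg : Measurable g) {τ : Y → Y} (hτ : Measurable τ) (hcov : ∀ U, d (τ U) = g (d U))
    {R : Y → ℝ≥0∞} (hR : Measurable R) (hcv : (m.withDensity R).map τ = m) :
    m.map d = ((m.map d).withDensity (fun W => ∫⁻ U, R U ∂(σ W))).map g := by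
  have hcomp : (d ∘ τ : Y → X) = g ∘ d := funext fun U => hcov U
  calc m.map d = ((m.withDensity R).map τ).map d := by rw [hcv]
    _ = (m.withDensity R).map (d ∘ τ) := Measure.map_map hd hτ
    _ = (m.withDensity R).map (g ∘ d) := by rw [hcomp]
    _ = ((m.withDensity R).map d).map g := (Measure.map_map hg hd).symm
    _ = ((m.map d).withDensity (fun W => ∫⁻ U, R U ∂(σ W))).map g := by
        rw [map_withDensity_eq m hd σ hbind hfib hR]

/-- ★ **`Z` IS A.E. FINITE** (total mass). [folklore] -/
theorem ae_lintegral_kernel_lt_top (m : Measure Y) [IsFiniteMeasure m] {d : Y → X} (hd : Measurable d)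
    (σ : Kernel X Y) (hbind : (m.map d).bind ⇑σ = m) (hfib : ∀ᵐ V ∂(m.map d), ∀ᵐ U ∂(σ V), d U = V)
    {g : X → X} (hg : Measurable g) {τ : Y → Y} (hτ : Measurable τ) (hcov : ∀ U, d (τ U) = g (d U))
    {R : Y → ℝ≥0∞} (hR : Measurable R) (hcv : (m.withDensity R).map τ = m) :
    ∀ᵐ W ∂(m.map d), ∫⁻ U, R U ∂(σ W) < ∞ := by
  have hZ : Measurable (fun W => ∫⁻ U, R U ∂(σ W)) := hR.lintegral_kernel
  have hB := map_eq_map_withDensity m hd σ hbind hfib hg hτ hcov hR hcv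
  have huniv : ((m.map d).withDensity (fun W => ∫⁻ U, R U ∂(σ W))) univ = (m.map d) univ := by
    conv_rhs => rw [hB]
    rw [Measure.map_apply hg MeasurableSet.univ, Set.preimage_univ]
  refine ae_lt_top hZ ?_
  rw [← setLIntegral_univ, ← withDensity_apply _ MeasurableSet.univ, huniv]
  exact measure_ne_top _ _

/-- ★ **THE COARSE MOVE IS NULL-PRESERVING FOR THE BASE LAW**: `(m.map d).map g ≪ m.map d` — a CONSEQUENCE of the change of variables and `R ≠ 0`,
not an extra hypothesis. [folklore] -/
theorem map_map_absolutelyContinuous (m : Measure Y) {d : Y → X} (hd : Measurable d)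
    (σ : Kernel X Y) [IsMarkovKernel σ] (hbind : (m.map d).bind ⇑σ = m) (hfib : ∀ᵐ V ∂(m.map d), ∀ᵐ U ∂(σ V), d U = V)
    {g : X → X} (hg : Measurable g) {τ : Y → Y} (hτ : Measurable τ) (hcov : ∀ U, d (τ U) = g (d U))
    {R : Y → ℝ≥0∞} (hR : Measurable R) (hRpos : ∀ U, R U ≠ 0) (hcv : (m.withDensity R).map τ = m) :
    (m.map d).map g ≪ m.map d := by
  have hZ : Measurable (fun W => ∫⁻ U, R U ∂(σ W)) := hR.lintegral_kernel
  have hB := map_eq_map_withDensity m hd σ hbind hfib hg hτ hcov hR hcv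
  refine Measure.AbsolutelyContinuous.mk fun s hs hs0 => ?_
  rw [Measure.map_apply hg hs]
  have h1 : ((m.map d).withDensity (fun W => ∫⁻ U, R U ∂(σ W))) (g ⁻¹' s) = 0 := by
    rw [← Measure.map_apply hg hs, ← hB]; exact hs0
  rw [withDensity_apply_eq_zero hZ] at h1
  have hset : {W | (∫⁻ U, R U ∂(σ W)) ≠ 0} ∩ g ⁻¹' s = g ⁻¹' s := by
    rw [Set.inter_eq_right]
    intro W _
    exact lintegral_kernel_ne_zero σ hR hRpos W
  rwa [hset] at h1

/-- ★ **THE INVERSE COARSE MOVE IS NULL-PRESERVING FOR THE BASE LAW**: `(m.map d).map g.symm = Z·(m.map d) ≪ m.map d`. [folklore] -/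
theorem map_symm_eq_withDensity (m : Measure Y) {d : Y → X} (hd : Measurable d)
    (σ : Kernel X Y) (hbind : (m.map d).bind ⇑σ = m) (hfib : ∀ᵐ V ∂(m.map d), ∀ᵐ U ∂(σ V), d U = V)
    (g : X ≃ᵐ X) {τ : Y → Y} (hτ : Measurable τ) (hcov : ∀ U, d (τ U) = g (d U))
    {R : Y → ℝ≥0∞} (hR : Measurable R) (hcv : (m.withDensity R).map τ = m) :
    (m.map d).map g.symm = (m.map d).withDensity (fun W => ∫⁻ U, R U ∂(σ W)) := by
  have hB := map_eq_map_withDensity m hd σ hbind hfib g.measurable hτ hcov hR hcv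
  conv_lhs => rw [hB]
  rw [Measure.map_map g.symm.measurable g.measurable, MeasurableEquiv.symm_comp_self, Measure.map_id]

/-- ★★★ **TRANSPORT OF A DISINTEGRATION** (see the module docstring).  For `(m.map d)`-a.e. `W`, the fibre law over the displaced base point `g W` is the
`τ`-image of the `R`-reweighted fibre law over `W`, normalised: `σ (g W) = (∫⁻ R ∂σ_W)⁻¹ • ((σ W).withDensity R).map τ`. [folklore; Mathlib
`eq_condKernel_of_measure_eq_compProd`] -/
theorem ae_eq_transport [StandardBorelSpace Y] [Nonempty Y] [MeasurableSingletonClass X]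
    (m : Measure Y) [IsFiniteMeasure m] {d : Y → X} (hd : Measurable d)
    (σ : Kernel X Y) [IsMarkovKernel σ]
    (hbind : (m.map d).bind ⇑σ = m) (hfib : ∀ᵐ V ∂(m.map d), ∀ᵐ U ∂(σ V), d U = V)
    (g : X ≃ᵐ X) {τ : Y → Y} (hτ : Measurable τ) (hcov : ∀ U, d (τ U) = g (d U))
    {R : Y → ℝ≥0∞} (hR : Measurable R) (hRpos : ∀ U, R U ≠ 0)
    (hcv : (m.withDensity R).map τ = m) :
    ∀ᵐ W ∂(m.map d), σ (g W) = (∫⁻ U, R U ∂(σ W))⁻¹ • ((σ W).withDensity R).map τ := by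
  -- notation and the letters of §2
  set ν : Measure X := m.map d with hν
  set Z : X → ℝ≥0∞ := fun W => ∫⁻ U, R U ∂(σ W) with hZdef
  have hZ : Measurable Z := hR.lintegral_kernel
  have hZne : ∀ W, Z W ≠ 0 := fun W => lintegral_kernel_ne_zero σ hR hRpos W
  have hB : ν = (ν.withDensity Z).map g := map_eq_map_withDensity m hd σ hbind hfib g.measurable hτ hcov hR hcv
  have hZfin : ∀ᵐ W ∂ν, Z W < ∞ := ae_lintegral_kernel_lt_top m hd σ hbind hfib g.measurable hτ hcov hR hcv
  have hνg : ν.map g ≪ ν := map_map_absolutelyContinuous m hd σ hbind hfib g.measurable hτ hcov hR hRpos hcv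
  have hνgs : ν.map g.symm ≪ ν := by
    have h := map_symm_eq_withDensity m hd σ hbind hfib g hτ hcov hR hcv
    rw [← hν] at h
    rw [h]
    exact withDensity_absolutelyContinuous _ _
  -- the transported-reweighted kernel `η V = ((σ (g⁻¹ V)).withDensity R).map τ`
  have hRu : Measurable (Function.uncurry fun (_ : X) (U : Y) => R U) := hR.comp measurable_snd
  set η : Kernel X Y := Kernel.comap (Kernel.map (Kernel.withDensity σ fun _ U => R U) τ) g.symm g.symm.measurable with hηdef
  have hη : ∀ V, η V = ((σ (g.symm V)).withDensity R).map τ := by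
    intro V
    rw [hηdef, Kernel.comap_apply, Kernel.map_apply _ hτ, Kernel.withDensity_apply σ hRu]
  have hηuniv : ∀ V, η V univ = Z (g.symm V) := by
    intro V
    rw [hη V, Measure.map_apply hτ MeasurableSet.univ, Set.preimage_univ, withDensity_apply _ MeasurableSet.univ,
      Measure.restrict_univ]
  -- the normalised kernel `κ V = (Z (g⁻¹ V))⁻¹ • η V` (finite: mass ≤ 1)
  have hκmeas : Measurable fun V : X => (Z (g.symm V))⁻¹ • η V := by
    refine Measure.measurable_of_measurable_coe _ fun s hs => ?_
    simp only [Measure.smul_apply, smul_eq_mul]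
    exact ((hZ.comp g.symm.measurable).inv).mul (η.measurable_coe hs)
  set κ : Kernel X Y := ⟨fun V => (Z (g.symm V))⁻¹ • η V, hκmeas⟩ with hκdef
  have hκ : ∀ V, κ V = (Z (g.symm V))⁻¹ • η V := fun V => rfl
  haveI : IsFiniteKernel κ := by
    refine ⟨⟨1, ENNReal.one_lt_top, fun V => ?_⟩⟩
    rw [hκ V, Measure.smul_apply, smul_eq_mul, hηuniv V]
    exact ENNReal.inv_mul_le_one _
  -- `κ` disintegrates `m` along `d`: the `bind` identity
  have hbindκ : ν.bind ⇑κ = m := by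
    ext s hs
    rw [Measure.bind_apply hs κ.measurable.aemeasurable]
    have hmeas : Measurable fun V => κ V s := κ.measurable_coe hs
    have hmeas' : Measurable fun W => κ (g W) s := hmeas.comp g.measurable
    rw [hB, lintegral_map hmeas g.measurable, lintegral_withDensity_eq_lintegral_mul _ hZ hmeas']
    have hae : (Z * fun W => κ (g W) s) =ᵐ[ν] fun W => ∫⁻ U, (τ ⁻¹' s).indicator R U ∂(σ W) := by
      filter_upwards [hZfin] with W hW
      simp only [Pi.mul_apply]
      rw [hκ (g W), Measure.smul_apply, smul_eq_mul, MeasurableEquiv.symm_apply_apply, ← mul_assoc,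
        ENNReal.mul_inv_cancel (hZne W) hW.ne, one_mul, hη (g W), MeasurableEquiv.symm_apply_apply,
        Measure.map_apply hτ hs, withDensity_apply _ (hτ hs), lintegral_indicator (hτ hs)]
    rw [lintegral_congr_ae hae, ← lintegral_eq_lintegral_kernel m σ hbind (hR.indicator (hτ hs)),
      lintegral_indicator (hτ hs), ← withDensity_apply _ (hτ hs), ← Measure.map_apply hτ hs, hcv]
  -- `κ` disintegrates `m` along `d`: the fibre clause
  have hfibκ : ∀ᵐ V ∂ν, ∀ᵐ U ∂(κ V), d U = V := by
    have h1 : ∀ᵐ V ∂ν, ∀ᵐ U ∂(σ (g.symm V)), d U = g.symm V :=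
      ae_of_ae_map g.symm.measurable.aemeasurable (hνgs.ae_le hfib)
    filter_upwards [h1] with V hV
    rw [hκ V]
    refine Measure.ae_smul_measure ?_ _
    rw [hη V]
    have hset : MeasurableSet {U : Y | d U = V} := hd (measurableSet_singleton V)
    refine (ae_map_iff hτ.aemeasurable hset).mpr ?_
    refine (withDensity_absolutelyContinuous _ _).ae_le ?_
    filter_upwards [hV] with U hU
    show d (τ U) = V
    rw [hcov U, hU, MeasurableEquiv.apply_symm_apply]
  -- a.e. uniqueness, then transfer along `g`
  have hκσ : ∀ᵐ V ∂ν, κ V = σ V := ae_eq_of_bind_of_bind_finite m hd σ κ hbind hfib hbindκ hfibκ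
  have h2 : ∀ᵐ W ∂ν, κ (g W) = σ (g W) := ae_of_ae_map g.measurable.aemeasurable (hνg.ae_le hκσ)
  filter_upwards [h2] with W hW
  rw [← hW, hκ (g W), hη (g W), MeasurableEquiv.symm_apply_apply]

end Transport

/-! ## §3 Transport data compose (two one-bond moves ⇒ the diagonal corner of the square) -/

section Compose

variable {X Y : Type*} [MeasurableSpace X] [MeasurableSpace Y]

/-- `(R₁·(R₂∘τ₁))·μ` pushed by `τ₁` is `R₂·((R₁·μ).map τ₁)`. [folklore] -/
theorem map_withDensity_mul_comp (μ : Measure Y) {τ₁ : Y → Y} (hτ₁ : Measurable τ₁)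
    {R₁ R₂ : Y → ℝ≥0∞} (hR₁ : Measurable R₁) (hR₂ : Measurable R₂) :
    (μ.withDensity (fun U => R₁ U * R₂ (τ₁ U))).map τ₁ = ((μ.withDensity R₁).map τ₁).withDensity R₂ := by
  ext s hs
  have hmeas : Measurable fun a => s.indicator R₂ (τ₁ a) := (hR₂.indicator hs).comp hτ₁
  rw [Measure.map_apply hτ₁ hs, withDensity_apply _ (hτ₁ hs), withDensity_apply _ hs,
    ← lintegral_indicator hs, lintegral_map (hR₂.indicator hs) hτ₁,
    lintegral_withDensity_eq_lintegral_mul _ hR₁ hmeas, ← lintegral_indicator (hτ₁ hs)]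
  refine lintegral_congr_ae (Eventually.of_forall fun U => ?_)
  by_cases hU : τ₁ U ∈ s
  · have hU' : U ∈ τ₁ ⁻¹' s := hU
    rw [Set.indicator_of_mem hU', Pi.mul_apply, Set.indicator_of_mem hU]
  · have hU' : U ∉ τ₁ ⁻¹' s := hU
    rw [Set.indicator_of_notMem hU', Pi.mul_apply, Set.indicator_of_notMem hU, mul_zero]

/-- ★ **CHANGE-OF-VARIABLES LETTERS COMPOSE**: `(R₁·m).map τ₁ = m`, `(R₂·m).map τ₂ = m` ⟹ `((R₁·(R₂∘τ₁))·m).map (τ₂ ∘ τ₁) = m`. [folklore] -/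
theorem cv_comp (m : Measure Y) {τ₁ τ₂ : Y → Y} (hτ₁ : Measurable τ₁) (hτ₂ : Measurable τ₂)
    {R₁ R₂ : Y → ℝ≥0∞} (hR₁ : Measurable R₁) (hR₂ : Measurable R₂)
    (hcv₁ : (m.withDensity R₁).map τ₁ = m) (hcv₂ : (m.withDensity R₂).map τ₂ = m) :
    (m.withDensity (fun U => R₁ U * R₂ (τ₁ U))).map (τ₂ ∘ τ₁) = m := by
  rw [← Measure.map_map hτ₂ hτ₁, map_withDensity_mul_comp m hτ₁ hR₁ hR₂, hcv₁, hcv₂]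

omit [MeasurableSpace Y] in
/-- ★ **COVERING IDENTITIES COMPOSE**: `d ∘ τ₁ = g₁ ∘ d`, `d ∘ τ₂ = g₂ ∘ d` ⟹ `d ∘ (τ₂ ∘ τ₁) = (g₁.trans g₂) ∘ d`. [folklore] -/
theorem cov_comp {d : Y → X} {τ₁ τ₂ : Y → Y} (g₁ g₂ : X ≃ᵐ X)
    (hcov₁ : ∀ U, d (τ₁ U) = g₁ (d U)) (hcov₂ : ∀ U, d (τ₂ U) = g₂ (d U)) :
    ∀ U, d ((τ₂ ∘ τ₁) U) = (g₁.trans g₂) (d U) := by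
  intro U
  rw [Function.comp_apply, hcov₂, hcov₁, MeasurableEquiv.trans_apply]

/-- ★ **a.e. STATEMENTS MOVE ALONG THE FIRST COARSE MOVE**: an `(m.map d)`-a.e. property `p` holds at `g W` for `(m.map d)`-a.e. `W` — so the
transport identities at the corner `V = g₁ W` (towards the diagonal corner `g₂ (g₁ W)`) are available for a.e. REFERENCE corner `W`. [folklore] -/
theorem ae_comp_of_ae [MeasurableSingletonClass X]
    (m : Measure Y) {d : Y → X} (hd : Measurable d)
    (σ : Kernel X Y) [IsMarkovKernel σ] (hbind : (m.map d).bind ⇑σ = m) (hfib : ∀ᵐ V ∂(m.map d), ∀ᵐ U ∂(σ V), d U = V)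
    (g : X ≃ᵐ X) {τ : Y → Y} (hτ : Measurable τ) (hcov : ∀ U, d (τ U) = g (d U))
    {R : Y → ℝ≥0∞} (hR : Measurable R) (hRpos : ∀ U, R U ≠ 0) (hcv : (m.withDensity R).map τ = m)
    {p : X → Prop} (h : ∀ᵐ V ∂(m.map d), p V) : ∀ᵐ W ∂(m.map d), p (g W) :=
  ae_of_ae_map g.measurable.aemeasurable
    ((map_map_absolutelyContinuous m hd σ hbind hfib g.measurable hτ hcov hR hRpos hcv).ae_le h)

end Compose

end Summit.QuantumFields.YangMills.Theorems.OrganTangentDisintegrationTransport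

end
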